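import Summits.CriticalPhenomena.SAWScalingLimit.Theses.SAWDefectDecoherence
import Literature.Probability.LatticeModels.TriangularLatticeProofs
import Literature.Probability.RandomPlanarGeometry.CaratheodoryHalfPlane
import Literature.Probability.Percolation.CanonicalDiscretisationTies

/-!
# `HexConjecture` — negative knowledge: every clause of `IsEmbEndpointApprox` is load-bearing

Support file for crux `stmt-CriticalPhenomena-0808` (cdisprove): the crux with any one clause of
`IsEmbEndpointApprox` dropped is FALSE (`hexConjecture_false_without_tendsto_snd / _fst / _reachable`).
-/

noncomputable section

namespace Summit.CriticalPhenomena.SAWScalingLimit.Cruxes.HexConjecture.Negative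

open MeasureTheory Filter Topology Set
open Literature.Probability.LatticeModels Literature.Probability.RandomPlanarGeometry
open Literature.Probability.RandomPlanarGeometry.SAW Literature.Probability.Process
open scoped NNReal ENNReal BoundedContinuousFunction

/-! ## §1 Engines: endpoints of SLE sample curves; total mass; endpoint laws -/

section Engines

variable {κ : ℝ≥0} {D : DobrushinDomain} {Γ : (ℝ≥0 → ℝ) → CurveClass ℂ}

/-- An SLE_κ sample curve in `(D; a, b)` a.s. STARTS at `D.pt 0` (`Loewner.trace_zero`,
`sleDriving_zero`, chordal normalisation `0 ↦ D.pt 0`). [folklore] -/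
theorem IsSLECurve.ae_source_eq (h : IsSLECurve κ D Γ) :
    ∀ᵐ ω ∂preWienerMeasure, (Γ ω).source = D.pt 0 := by
  obtain ⟨-, φ, hφ, hae⟩ := h
  filter_upwards [hae] with ω hω
  obtain ⟨-, c, hΓ, hcs, -⟩ := hω
  have h0 : ((0 : unitInterval) : ℝ) < 1 := by norm_num
  rw [hΓ, CurveClass.source_mk, Curve.source_def, hcs 0 h0, rayParam_zero]
  have htr : sleTrace κ ω 0 = 0 := by
    simp [sleTrace]
  rw [htr]
  exact φ.boundaryExtension_eq_of_hasBoundaryValue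
    (mem_closure_upperHalfPlaneSet_iff.2 (by simp)) hφ.1

/-- An SLE_κ sample curve in `(D; a, b)` a.s. ENDS at `D.pt 1` (`IsCompactifiedImage`). [folklore] -/
theorem IsSLECurve.ae_target_eq (h : IsSLECurve κ D Γ) :
    ∀ᵐ ω ∂preWienerMeasure, (Γ ω).target = D.pt 1 := by
  obtain ⟨-, φ, -, hae⟩ := h
  filter_upwards [hae] with ω hω
  obtain ⟨-, c, hΓ, -, hc1⟩ := hω
  rw [hΓ, CurveClass.target_mk, Curve.target_def, hc1]

variable {Ωδ : ℝ → Type*} [∀ δ, MeasurableSpace (Ωδ δ)] {X : ∀ δ, Ωδ δ → CurveClass ℂ}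
  {P : ∀ δ, Measure (Ωδ δ)}

/-- Portmanteau convergence of eventually-probability laws to a random variable on the canonical
space forces `preWienerMeasure univ = 1` (test function `1`; no named fact). [folklore] -/
theorem isProbabilityMeasure_preWiener_of_tendstoLaw
    (hP : ∀ᶠ δ in 𝓝[>] (0 : ℝ), IsProbabilityMeasure (P δ))
    (h : TendstoLaw X P Γ preWienerMeasure) : IsProbabilityMeasure preWienerMeasure := by
  have h1 := h (BoundedContinuousFunction.const _ 1)
  simp only [BoundedContinuousFunction.const_apply, integral_const, smul_eq_mul, mul_one] at h1
  have h2 : Tendsto (fun δ => (P δ).real univ) (𝓝[>] (0 : ℝ)) (𝓝 1) :=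
    tendsto_const_nhds.congr' (by
      filter_upwards [hP] with δ hδ
      exact (probReal_univ (μ := P δ)).symm)
  exact isProbabilityMeasure_iff_real.2 (tendsto_nhds_unique h1 h2)

/-- A bounded continuous real test function on `ℂ` separating `1` from `-1`: the clamped real
part `z ↦ max (-1) (min 1 (re z))`. [folklore] -/
def clampRe : ℂ →ᵇ ℝ :=
  BoundedContinuousFunction.ofNormedAddCommGroup (fun z : ℂ => max (-1) (min 1 z.re))
    (by fun_prop) 1 (fun z => by
      rw [Real.norm_eq_abs, abs_le]
      exact ⟨le_max_left _ _, max_le (by norm_num) (min_le_left _ _)⟩)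

/-- Value of `clampRe`. [folklore] -/
@[simp] theorem clampRe_apply (z : ℂ) : clampRe z = max (-1) (min 1 z.re) := rfl

/-- `clampRe 1 = 1`. [folklore] -/
theorem clampRe_one : clampRe 1 = 1 := by simp

/-- `clampRe (-1) = -1`. [folklore] -/
theorem clampRe_neg_one : clampRe (-1) = -1 := by simp

/-- Endpoint law, target: under `ConvergesInLawToSLE` with eventually-probability laws,
`∫ g(target(X δ)) dP δ → g (D.pt 1)` for bounded continuous `g` (no named fact). [folklore] -/
theorem tendsto_integral_target (hconv : ConvergesInLawToSLE κ D X P)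
    (hP : ∀ᶠ δ in 𝓝[>] (0 : ℝ), IsProbabilityMeasure (P δ)) (g : ℂ →ᵇ ℝ) :
    Tendsto (fun δ => ∫ ω, g ((X δ ω).target) ∂P δ) (𝓝[>] (0 : ℝ)) (𝓝 (g (D.pt 1))) := by
  obtain ⟨Γ, hΓ, -, hlaw⟩ := hconv
  haveI := isProbabilityMeasure_preWiener_of_tendstoLaw hP hlaw
  have h := hlaw (g.compContinuous ⟨CurveClass.target, CurveClass.continuous_target⟩)
  simp only [BoundedContinuousFunction.compContinuous_apply, ContinuousMap.coe_mk] at h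
  have hrhs : ∫ ω, g ((Γ ω).target) ∂preWienerMeasure = g (D.pt 1) := by
    rw [integral_congr_ae (g := fun _ => g (D.pt 1)) ?_, integral_const, probReal_univ, one_smul]
    filter_upwards [IsSLECurve.ae_target_eq hΓ] with ω hω
    simp [hω]
  rwa [hrhs] at h

/-- Endpoint law, source: under `ConvergesInLawToSLE` with eventually-probability laws,
`∫ g(source(X δ)) dP δ → g (D.pt 0)` for bounded continuous `g` (no named fact). [folklore] -/
theorem tendsto_integral_source (hconv : ConvergesInLawToSLE κ D X P)
    (hP : ∀ᶠ δ in 𝓝[>] (0 : ℝ), IsProbabilityMeasure (P δ)) (g : ℂ →ᵇ ℝ) :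
    Tendsto (fun δ => ∫ ω, g ((X δ ω).source) ∂P δ) (𝓝[>] (0 : ℝ)) (𝓝 (g (D.pt 0))) := by
  obtain ⟨Γ, hΓ, -, hlaw⟩ := hconv
  haveI := isProbabilityMeasure_preWiener_of_tendstoLaw hP hlaw
  have h := hlaw (g.compContinuous ⟨CurveClass.source, CurveClass.continuous_source⟩)
  simp only [BoundedContinuousFunction.compContinuous_apply, ContinuousMap.coe_mk] at h
  have hrhs : ∫ ω, g ((Γ ω).source) ∂preWienerMeasure = g (D.pt 0) := by
    rw [integral_congr_ae (g := fun _ => g (D.pt 0)) ?_, integral_const, probReal_univ, one_smul]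
    filter_upwards [IsSLECurve.ae_source_eq hΓ] with ω hω
    simp [hω]
  rwa [hrhs] at h

end Engines

/-! ## §2 Witnesses on the honeycomb lattice and the unit disc -/

section Witnesses

/-- `DobrushinDomain.unitDisc.pt 1 = -1`. [folklore] -/
theorem unitDisc_pt_one : DobrushinDomain.unitDisc.pt 1 = -1 := by
  simp [MarkedDomain.pt, DobrushinDomain.unitDisc, JordanDomain.unitDisc, circleMap]
  rw [show (2 * (Real.pi : ℂ) * 2⁻¹ * Complex.I) = Real.pi * Complex.I by ring]
  exact Complex.exp_pi_mul_I

/-- The up-face of the cell `(n, 0)`; its centre is `n + 1/2 + i√3/6`. [folklore] -/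
def vOut (n : ℤ) : HexVertex := (![n, 0], 0)

/-- Centre of `vOut n`. [folklore] -/
theorem hexCenter_vOut (n : ℤ) :
    hexCenter (vOut n) = (((n : ℝ) + 1 / 2 : ℝ) : ℂ) + ((Real.sqrt 3 / 6 : ℝ) : ℂ) * Complex.I := by
  apply Complex.ext <;> simp [vOut, hexCenter, triEmbed, triZeta_re, triZeta_im] <;> ring

/-- Lattice points approaching `+1` from OUTSIDE the disc: `δ·centre = δ(⌈δ⁻¹⌉₊ + 3/2) + iδ√3/6`. [folklore] -/
def aOut (δ : ℝ) : HexVertex := vOut ((⌈δ⁻¹⌉₊ + 1 : ℕ) : ℤ)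

/-- Lattice points whose rescalings approach `-1` from OUTSIDE the closed unit disc. [folklore] -/
def bOut (δ : ℝ) : HexVertex := vOut (-(((⌈δ⁻¹⌉₊ + 2 : ℕ) : ℤ)))

/-- `δ ⌈1/δ⌉₊ → 1` as `δ → 0⁺`. [folklore] -/
theorem tendsto_mul_natCeil_inv :
    Tendsto (fun δ : ℝ => δ * (⌈δ⁻¹⌉₊ : ℝ)) (𝓝[>] (0 : ℝ)) (𝓝 1) := by
  have h := (tendsto_nat_ceil_div_atTop (R := ℝ)).comp tendsto_inv_nhdsGT_zero
  refine h.congr' (Eventually.of_forall fun δ => ?_)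
  simp [div_inv_eq_mul, mul_comm]

/-- `1 ≤ δ ⌈1/δ⌉₊` for `δ > 0`. [folklore] -/
theorem one_le_mul_natCeil_inv {δ : ℝ} (hδ : 0 < δ) : 1 ≤ δ * (⌈δ⁻¹⌉₊ : ℝ) := by
  calc (1 : ℝ) = δ * δ⁻¹ := by field_simp
    _ ≤ δ * (⌈δ⁻¹⌉₊ : ℝ) := by gcongr; exact Nat.le_ceil _

/-- The rescaled point `δ · centre(aOut δ)` in coordinates. [folklore] -/
theorem smul_hexCenter_aOut (δ : ℝ) :
    (δ : ℂ) * hexCenter (aOut δ) =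
      ((δ * (⌈δ⁻¹⌉₊ : ℝ) + δ * (3 / 2) : ℝ) : ℂ) + ((δ * (Real.sqrt 3 / 6) : ℝ) : ℂ) * Complex.I := by
  rw [aOut, hexCenter_vOut]; push_cast; ring

/-- The rescaled point `δ · centre(bOut δ)` in coordinates. [folklore] -/
theorem smul_hexCenter_bOut (δ : ℝ) :
    (δ : ℂ) * hexCenter (bOut δ) =
      ((-(δ * (⌈δ⁻¹⌉₊ : ℝ) + δ * (3 / 2)) : ℝ) : ℂ) + ((δ * (Real.sqrt 3 / 6) : ℝ) : ℂ) * Complex.I := by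
  rw [bOut, hexCenter_vOut]; push_cast; ring

/-- `δ · centre(aOut δ) → 1`. [folklore] -/
theorem tendsto_aOut :
    Tendsto (fun δ : ℝ => (δ : ℂ) * hexCenter (aOut δ)) (𝓝[>] (0 : ℝ)) (𝓝 1) := by
  have h0 : Tendsto (fun δ : ℝ => δ) (𝓝[>] (0 : ℝ)) (𝓝 0) :=
    tendsto_nhdsWithin_of_tendsto_nhds tendsto_id
  have h1 : Tendsto (fun δ : ℝ => δ * (⌈δ⁻¹⌉₊ : ℝ) + δ * (3 / 2)) (𝓝[>] (0 : ℝ)) (𝓝 1) := by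
    simpa using tendsto_mul_natCeil_inv.add (h0.mul_const (3 / 2 : ℝ))
  have h2 : Tendsto (fun δ : ℝ => δ * (Real.sqrt 3 / 6)) (𝓝[>] (0 : ℝ)) (𝓝 0) := by
    simpa using h0.mul_const (Real.sqrt 3 / 6 : ℝ)
  have h3 := ((Complex.continuous_ofReal.tendsto 1).comp h1).add
    (((Complex.continuous_ofReal.tendsto 0).comp h2).mul_const Complex.I)
  simp only [Function.comp_def, Complex.ofReal_one, Complex.ofReal_zero, zero_mul, add_zero] at h3
  refine h3.congr' (Eventually.of_forall fun δ => ?_)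
  beta_reduce
  rw [smul_hexCenter_aOut]

/-- `δ · centre(bOut δ) → -1`. [folklore] -/
theorem tendsto_bOut :
    Tendsto (fun δ : ℝ => (δ : ℂ) * hexCenter (bOut δ)) (𝓝[>] (0 : ℝ)) (𝓝 (-1)) := by
  have h0 : Tendsto (fun δ : ℝ => δ) (𝓝[>] (0 : ℝ)) (𝓝 0) :=
    tendsto_nhdsWithin_of_tendsto_nhds tendsto_id
  have h1 : Tendsto (fun δ : ℝ => -(δ * (⌈δ⁻¹⌉₊ : ℝ) + δ * (3 / 2))) (𝓝[>] (0 : ℝ)) (𝓝 (-1)) := by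
    simpa using (tendsto_mul_natCeil_inv.add (h0.mul_const (3 / 2 : ℝ))).neg
  have h2 : Tendsto (fun δ : ℝ => δ * (Real.sqrt 3 / 6)) (𝓝[>] (0 : ℝ)) (𝓝 0) := by
    simpa using h0.mul_const (Real.sqrt 3 / 6 : ℝ)
  have h3 := ((Complex.continuous_ofReal.tendsto (-1)).comp h1).add
    (((Complex.continuous_ofReal.tendsto 0).comp h2).mul_const Complex.I)
  simp only [Function.comp_def, Complex.ofReal_neg, Complex.ofReal_one, Complex.ofReal_zero,
    zero_mul, add_zero] at h3
  refine h3.congr' (Eventually.of_forall fun δ => ?_)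
  beta_reduce
  rw [smul_hexCenter_bOut]; push_cast; ring

/-- For `δ > 0` the point `δ · centre(aOut δ)` lies OUTSIDE the open unit disc. [folklore] -/
theorem aOut_not_mem_ball {δ : ℝ} (hδ : 0 < δ) :
    (δ : ℂ) * hexCenter (aOut δ) ∉ Metric.ball (0 : ℂ) 1 := by
  have hre : ((δ : ℂ) * hexCenter (aOut δ)).re = δ * (⌈δ⁻¹⌉₊ : ℝ) + δ * (3 / 2) := by
    rw [smul_hexCenter_aOut]; simp
  have h1 := one_le_mul_natCeil_inv hδ
  rw [Metric.mem_ball, dist_zero_right, not_lt]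
  calc (1 : ℝ) ≤ |((δ : ℂ) * hexCenter (aOut δ)).re| := by rw [hre, abs_of_pos (by positivity)]; linarith
    _ ≤ _ := Complex.abs_re_le_norm _

/-- For `δ > 0` the point `δ · centre(bOut δ)` lies OUTSIDE the open unit disc. [folklore] -/
theorem bOut_not_mem_ball {δ : ℝ} (hδ : 0 < δ) :
    (δ : ℂ) * hexCenter (bOut δ) ∉ Metric.ball (0 : ℂ) 1 := by
  have hre : ((δ : ℂ) * hexCenter (bOut δ)).re = -(δ * (⌈δ⁻¹⌉₊ : ℝ) + δ * (3 / 2)) := by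
    rw [smul_hexCenter_bOut]; simp
  have h1 := one_le_mul_natCeil_inv hδ
  rw [Metric.mem_ball, dist_zero_right, not_lt]
  calc (1 : ℝ) ≤ |((δ : ℂ) * hexCenter (bOut δ)).re| := by
        rw [hre, abs_neg, abs_of_pos (by positivity)]; linarith
    _ ≤ _ := Complex.abs_re_le_norm _

/-- `aOut δ ≠ bOut δ`. [folklore] -/
theorem aOut_ne_bOut (δ : ℝ) : aOut δ ≠ bOut δ := by
  intro h
  have h' := congrArg (fun v : HexVertex => v.1 0) h
  simp [aOut, bOut, vOut] at h'
  omega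

/-! ### Junk analysis of the SAW law: no walk from an isolated vertex; the diagonal law -/

variable {Ω : Set ℂ} {δ : ℝ} {a b v : HexVertex}

/-- A vertex whose rescaled centre is not in `Ω` is isolated in `Ω_δ`; no walk leaves it. [folklore] -/
theorem not_reachable_of_not_mem (ha : (δ : ℂ) * hexCenter a ∉ Ω) (hab : a ≠ b) :
    ¬ (hexDomainGraph Ω δ).Reachable a b := by
  rintro ⟨p⟩
  cases p with
  | nil => exact hab rfl
  | cons h _ =>
    have hmem := ((embDomainGraph_adj_iff hexGraph hexCenter).1 h).2.1
    exact ha ((mem_embMeshVertices_iff hexCenter).1 (embMeshDomain_subset hexGraph hexCenter Ω δ hmem))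

/-- … hence the SAW space is empty, [folklore] -/
theorem isEmpty_saw_of_not_mem (ha : (δ : ℂ) * hexCenter a ∉ Ω) (hab : a ≠ b) :
    IsEmpty (HexDomainSAW Ω δ a b) :=
  ⟨fun γ => not_reachable_of_not_mem ha hab ⟨γ.walk⟩⟩

/-- … and the law `hexSAWLaw` is the junk ZERO measure. [folklore] -/
theorem hexSAWLaw_eq_zero_of_not_mem (ha : (δ : ℂ) * hexCenter a ∉ Ω) (hab : a ≠ b) :
    hexSAWLaw Ω δ a b = 0 := by
  haveI := isEmpty_saw_of_not_mem ha hab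
  exact Measure.eq_zero_of_isEmpty _

/-- With coincident endpoints the only SAW is the trivial walk. [folklore] -/
theorem saw_diag_eq_nil (γ : HexDomainSAW Ω δ v v) : γ = EmbDomainSAW.nil v := by
  obtain ⟨w, hw⟩ := γ
  obtain rfl := SimpleGraph.Walk.eq_nil_iff_nil.2 (SimpleGraph.Walk.isPath_iff_nil.1 hw)
  rfl

/-- Total weight of the diagonal SAW space: `x_c` (one vertex). [folklore] -/
theorem hexSAWWeight_diag_univ : hexSAWWeight Ω δ v v univ = ENNReal.ofReal hexCriticalFugacity := by
  have h : (univ : Set (HexDomainSAW Ω δ v v)) = {EmbDomainSAW.nil v} := by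
    ext γ; simp [saw_diag_eq_nil γ]
  rw [h, hexSAWWeight_singleton, EmbDomainSAW.vertexCount_nil, pow_one]

/-- The diagonal law is a probability measure (a Dirac mass at the trivial walk) — for EVERY
`Ω`, `δ`, `v`, reachable or not, inside `Ω` or not. [folklore] -/
theorem isProbabilityMeasure_hexSAWLaw_diag : IsProbabilityMeasure (hexSAWLaw Ω δ v v) :=
  isProbabilityMeasure_hexSAWLaw
    (by rw [hexSAWWeight_diag_univ]; exact (ENNReal.ofReal_pos.2 hexCriticalFugacity_pos_lt_one.1).ne')
    (by rw [hexSAWWeight_diag_univ]; exact ENNReal.ofReal_ne_top)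

/-- Evaluation of a curve built from a continuous map. [folklore] -/
@[simp] theorem curve_mk_apply (f : C(unitInterval, ℂ)) (t : unitInterval) :
    (Curve.mk f : Curve ℂ) t = f t := rfl

/-- The curve of a diagonal SAW is the constant curve at `δ · centre v`: its target … [folklore] -/
theorem curve_target_diag (γ : HexDomainSAW Ω δ v v) : γ.curve.target = (δ : ℂ) * hexCenter v := by
  rw [saw_diag_eq_nil γ]
  simp [EmbDomainSAW.curve, EmbDomainSAW.nil, Curve.target_def, SimpleGraph.Walk.toCurve, polyline]

/-- … and its source. [folklore] -/
theorem curve_source_diag (γ : HexDomainSAW Ω δ v v) : γ.curve.source = (δ : ℂ) * hexCenter v := by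
  rw [saw_diag_eq_nil γ]
  simp [EmbDomainSAW.curve, EmbDomainSAW.nil, Curve.source_def]

end Witnesses

/-! ## §3 Load-bearing analysis: each clause of `IsEmbEndpointApprox` is necessary -/

section LoadBearing

/-- The crux with clause (iii) of `IsEmbEndpointApprox` (`δ · b_δ → b`) DROPPED. -/
def HexConjectureWithoutTendstoSnd : Prop :=
  ∀ (D : DobrushinDomain) (a b : ℝ → HexVertex),
    (∀ᶠ δ in 𝓝[>] (0 : ℝ), (hexDomainGraph D.carrier δ).Reachable (a δ) (b δ)) →
    Tendsto (fun δ : ℝ => (δ : ℂ) * hexCenter (a δ)) (𝓝[>] (0 : ℝ)) (𝓝 (D.pt 0)) →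
    ConvergesInLawToSLE ((8 : ℝ≥0) / 3) D
      (fun δ (γ : HexDomainSAW D.carrier δ (a δ) (b δ)) => γ.curve)
      (fun δ => hexSAWLaw D.carrier δ (a δ) (b δ))

/-- The crux with clause (ii) of `IsEmbEndpointApprox` (`δ · a_δ → a`) DROPPED. -/
def HexConjectureWithoutTendstoFst : Prop :=
  ∀ (D : DobrushinDomain) (a b : ℝ → HexVertex),
    (∀ᶠ δ in 𝓝[>] (0 : ℝ), (hexDomainGraph D.carrier δ).Reachable (a δ) (b δ)) →
    Tendsto (fun δ : ℝ => (δ : ℂ) * hexCenter (b δ)) (𝓝[>] (0 : ℝ)) (𝓝 (D.pt 1)) →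
    ConvergesInLawToSLE ((8 : ℝ≥0) / 3) D
      (fun δ (γ : HexDomainSAW D.carrier δ (a δ) (b δ)) => γ.curve)
      (fun δ => hexSAWLaw D.carrier δ (a δ) (b δ))

/-- The crux with clause (i) of `IsEmbEndpointApprox` (eventual reachability in `Ω_δ`) DROPPED. -/
def HexConjectureWithoutReachable : Prop :=
  ∀ (D : DobrushinDomain) (a b : ℝ → HexVertex),
    Tendsto (fun δ : ℝ => (δ : ℂ) * hexCenter (a δ)) (𝓝[>] (0 : ℝ)) (𝓝 (D.pt 0)) →
    Tendsto (fun δ : ℝ => (δ : ℂ) * hexCenter (b δ)) (𝓝[>] (0 : ℝ)) (𝓝 (D.pt 1)) →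
    ConvergesInLawToSLE ((8 : ℝ≥0) / 3) D
      (fun δ (γ : HexDomainSAW D.carrier δ (a δ) (b δ)) => γ.curve)
      (fun δ => hexSAWLaw D.carrier δ (a δ) (b δ))

/-- **Any proof must use clause (iii).** Witness: unit disc, `a_δ = b_δ = aOut δ → 1 = pt 0`
(reachability is trivial for coincident endpoints): the SAW law is the Dirac mass at the constant
curve sitting at `δ·aOut δ → 1`, whose TARGET law converges to `δ_1`, while SLE_{8/3} sample curves
end at `pt 1 = -1` a.s. NO named fact is used. [folklore] -/
theorem hexConjecture_false_without_tendsto_snd : ¬ HexConjectureWithoutTendstoSnd := by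
  intro h
  have hconv := h DobrushinDomain.unitDisc aOut aOut
    (Eventually.of_forall fun δ => SimpleGraph.Reachable.refl _)
    (by rw [Literature.Probability.Percolation.unitDisc_pt_zero]; exact tendsto_aOut)
  have hP : ∀ᶠ δ in 𝓝[>] (0 : ℝ),
      IsProbabilityMeasure (hexSAWLaw DobrushinDomain.unitDisc.carrier δ (aOut δ) (aOut δ)) :=
    Eventually.of_forall fun δ => isProbabilityMeasure_hexSAWLaw_diag
  have ht := tendsto_integral_target hconv hP clampRe
  have ht' : Tendsto (fun δ : ℝ => ∫ γ, clampRe ((γ : HexDomainSAW DobrushinDomain.unitDisc.carrier δ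
      (aOut δ) (aOut δ)).curve.target) ∂(hexSAWLaw DobrushinDomain.unitDisc.carrier δ (aOut δ) (aOut δ)))
      (𝓝[>] (0 : ℝ)) (𝓝 (clampRe 1)) := by
    have hc : Tendsto (fun δ : ℝ => clampRe ((δ : ℂ) * hexCenter (aOut δ))) (𝓝[>] (0 : ℝ))
        (𝓝 (clampRe 1)) := (clampRe.continuous.tendsto 1).comp tendsto_aOut
    refine hc.congr' (Eventually.of_forall fun δ => ?_)
    haveI : IsProbabilityMeasure (hexSAWLaw DobrushinDomain.unitDisc.carrier δ (aOut δ) (aOut δ)) :=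
      isProbabilityMeasure_hexSAWLaw_diag
    simp_rw [curve_target_diag]
    rw [integral_const, probReal_univ, one_smul]
  have huniq := tendsto_nhds_unique ht ht'
  rw [unitDisc_pt_one, clampRe_neg_one, clampRe_one] at huniq
  norm_num at huniq

/-- **Any proof must use clause (ii).** Witness: unit disc, `a_δ = b_δ = bOut δ → -1 = pt 1`:
the SOURCE law of the Dirac SAW law converges to `δ_{-1}`, while SLE_{8/3} sample curves start at
`pt 0 = 1` a.s. (`Loewner.trace_zero`). NO named fact is used. [folklore] -/
theorem hexConjecture_false_without_tendsto_fst : ¬ HexConjectureWithoutTendstoFst := by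
  intro h
  have hconv := h DobrushinDomain.unitDisc bOut bOut
    (Eventually.of_forall fun δ => SimpleGraph.Reachable.refl _)
    (by rw [unitDisc_pt_one]; exact tendsto_bOut)
  have hP : ∀ᶠ δ in 𝓝[>] (0 : ℝ),
      IsProbabilityMeasure (hexSAWLaw DobrushinDomain.unitDisc.carrier δ (bOut δ) (bOut δ)) :=
    Eventually.of_forall fun δ => isProbabilityMeasure_hexSAWLaw_diag
  have ht := tendsto_integral_source hconv hP clampRe
  have ht' : Tendsto (fun δ : ℝ => ∫ γ, clampRe ((γ : HexDomainSAW DobrushinDomain.unitDisc.carrier δ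
      (bOut δ) (bOut δ)).curve.source) ∂(hexSAWLaw DobrushinDomain.unitDisc.carrier δ (bOut δ) (bOut δ)))
      (𝓝[>] (0 : ℝ)) (𝓝 (clampRe (-1))) := by
    have hc : Tendsto (fun δ : ℝ => clampRe ((δ : ℂ) * hexCenter (bOut δ))) (𝓝[>] (0 : ℝ))
        (𝓝 (clampRe (-1))) := (clampRe.continuous.tendsto (-1)).comp tendsto_bOut
    refine hc.congr' (Eventually.of_forall fun δ => ?_)
    haveI : IsProbabilityMeasure (hexSAWLaw DobrushinDomain.unitDisc.carrier δ (bOut δ) (bOut δ)) :=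
      isProbabilityMeasure_hexSAWLaw_diag
    simp_rw [curve_source_diag]
    rw [integral_const, probReal_univ, one_smul]
  have huniq := tendsto_nhds_unique ht ht'
  rw [Literature.Probability.Percolation.unitDisc_pt_zero, clampRe_neg_one, clampRe_one] at huniq
  norm_num at huniq

/-- **Any proof must use clause (i).** Witness: unit disc, `a_δ = aOut δ → 1`, `b_δ = bOut δ → -1`
from OUTSIDE the disc: both endpoints are isolated in `Ω_δ`, the SAW space is EMPTY and the law is
the junk zero measure for every `δ > 0`, which converges in the portmanteau sense to nothing of
total mass `1`. Uses only `isProjectiveLimit_preWienerMeasure` (the standing hypothesis that makes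
`preWienerMeasure` a probability measure; without it the zero law "converges" to a zero target). [folklore] -/
theorem hexConjecture_false_without_reachable (hW : isProjectiveLimit_preWienerMeasure) :
    ¬ HexConjectureWithoutReachable := by
  intro h
  obtain ⟨Γ, -, -, hlaw⟩ := h DobrushinDomain.unitDisc aOut bOut
    (by rw [Literature.Probability.Percolation.unitDisc_pt_zero]; exact tendsto_aOut) (by rw [unitDisc_pt_one]; exact tendsto_bOut)
  haveI := isProbabilityMeasure_preWienerMeasure hW
  have h1 := hlaw (BoundedContinuousFunction.const _ 1)
  simp only [BoundedContinuousFunction.const_apply, integral_const, smul_eq_mul, mul_one,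
    probReal_univ] at h1
  have h2 : Tendsto (fun δ => (hexSAWLaw DobrushinDomain.unitDisc.carrier δ (aOut δ) (bOut δ)).real
      univ) (𝓝[>] (0 : ℝ)) (𝓝 0) := by
    refine tendsto_const_nhds.congr' ?_
    filter_upwards [self_mem_nhdsWithin] with δ (hδ : 0 < δ)
    rw [Literature.Probability.Percolation.unitDisc_carrier, hexSAWLaw_eq_zero_of_not_mem (aOut_not_mem_ball hδ) (aOut_ne_bOut δ)]
    simp
  have := tendsto_nhds_unique h1 h2
  norm_num at this

end LoadBearing

end Summit.CriticalPhenomena.SAWScalingLimit.Cruxes.HexConjecture.Negative
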